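import Literature.Analysis.FluidPDE.ElgindiAngularLeibniz
import HarnessLib

/-!
# Iterated angular derivatives of the polar elliptic equation
([Elgindi2021] §7.3 Steps 4–5, §7.4; [ElgindiGhoulMasmoudi2021] §6)

Topic `Literature/Analysis/FluidPDE`. Proof file (everything proved, no definitions, no named
facts) on the proof path of the named fact
`Literature.Analysis.FluidPDE.Elgindi.ElgindiGhoulMasmoudi2021_stabilityCore`
(`ElgindiStabilityDecomposition.lean`). T. M. Elgindi, Ann. of Math. 194 (2021) =
arXiv:1904.04795, §7.3, proof of Proposition 7.7, Step 4 (p. 22 of the held text):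

> "Toward this end, we write: `−∂_θθΨ + ∂_θ(tan(θ)Ψ) = F₁`, where we know from the preceding
> steps that `|F₁ w/sin(2θ)^{η/2}|_{L²} ≤ C|F w/sin(2θ)^{η/2}|_{L²}`. Now we differentiate in `θ`
> once […]"

(and [ElgindiGhoulMasmoudi2021] §6: "it suffices to establish `𝓗ᵏ` estimates on just the angular part
of the equation: `−∂_θθΨ + ∂_θ(tan(θ)Ψ) = G`"). Here `F₁ = G = L(Ψ) + α²R²∂_RRΨ + α(5+α)R∂_RΨ + 6Ψ`
by the form of the operator (PolarBSL). This file links the abstract datum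
`A_k = −∂_θ^{k+2}Φ + ∂_θ^{k+1}(sin θφ)` of the level-`k` estimate
(`ElgindiAngularLevelEstimate.lean`) to the equation: **`A_k = ∂_θ^k G` on the open strip**
(`iterate_dθ_angular_eq`), together with the bookkeeping of iterated slice derivatives it rests on:
`iterate_dθ_congr` (functions equal on the strip have equal iterates there; the radial analogue
`iterate_Dz_congr` is in the tree), `iterate_dθ_add`,
`iterate_dθ_sub`, `iterate_dθ_neg`, `iterate_dθ_smul` (linearity for smooth slices),
`iterate_dθ_dz_comm` (`∂_θ^k∂_R = ∂_R∂_θ^k` on the strip), and the algebraic identity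
`L(Φ) + α²R²∂_RRΦ + α(5+α)R∂_RΦ + 6Φ = −∂_θθΦ + ∂_θ(tan θΦ)` (`ellipticOp_add_radial`).
-/

noncomputable section

open MeasureTheory Set Real Filter Function Finset
open _root_.Topology

namespace Literature.Analysis.FluidPDE

namespace Elgindi

/-! ### Iterates of functions equal on the strip -/

/-- Functions equal on the open strip have equal angular iterates there. [folklore] -/
theorem iterate_dθ_congr {f g : ℝ → ℝ → ℝ} (h : ∀ p ∈ strip, f p.1 p.2 = g p.1 p.2) (n : ℕ) :
    ∀ p ∈ strip, (dθ^[n] f) p.1 p.2 = (dθ^[n] g) p.1 p.2 := by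
  induction n generalizing f g with
  | zero => simpa using h
  | succ n ih =>
    intro p hp
    rw [Function.iterate_succ_apply, Function.iterate_succ_apply]
    exact ih (fun q hq => dθ_congr h hq) p hp

/-! ### Linearity of the iterates on smooth slices -/

/-- `∂_θ^n(f + g) = ∂_θ^n f + ∂_θ^n g` for `f, g ∈ Cⁿ(ℝ²)`. [folklore] -/
theorem iterate_dθ_add {f g : ℝ → ℝ → ℝ} {n : ℕ} (hf : ContDiff ℝ n (uncurry f)) (hg : ContDiff ℝ n (uncurry g)) (R θ : ℝ) :
    (dθ^[n] fun R θ => f R θ + g R θ) R θ = (dθ^[n] f) R θ + (dθ^[n] g) R θ := by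
  rw [iterate_dθ_apply, iterate_dθ_apply, iterate_dθ_apply]
  exact iteratedDeriv_fun_add (contDiff_slice_θ hf R).contDiffAt (contDiff_slice_θ hg R).contDiffAt

/-- `∂_θ^n(f − g) = ∂_θ^n f − ∂_θ^n g` for `f, g ∈ Cⁿ(ℝ²)`. [folklore] -/
theorem iterate_dθ_sub {f g : ℝ → ℝ → ℝ} {n : ℕ} (hf : ContDiff ℝ n (uncurry f)) (hg : ContDiff ℝ n (uncurry g)) (R θ : ℝ) :
    (dθ^[n] fun R θ => f R θ - g R θ) R θ = (dθ^[n] f) R θ - (dθ^[n] g) R θ := by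
  rw [iterate_dθ_apply, iterate_dθ_apply, iterate_dθ_apply]
  exact iteratedDeriv_fun_sub (contDiff_slice_θ hf R).contDiffAt (contDiff_slice_θ hg R).contDiffAt

/-- `∂_θ^n(−f) = −∂_θ^n f`. [folklore] -/
theorem iterate_dθ_neg (f : ℝ → ℝ → ℝ) (n : ℕ) (R θ : ℝ) :
    (dθ^[n] fun R θ => -f R θ) R θ = -(dθ^[n] f) R θ := by
  rw [iterate_dθ_apply, iterate_dθ_apply]
  exact iteratedDeriv_fun_neg n _ θ

/-- `∂_θ^n(c·f) = c·∂_θ^n f` for a constant `c`. [folklore] -/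
theorem iterate_dθ_smul (c : ℝ) (f : ℝ → ℝ → ℝ) (n : ℕ) (R θ : ℝ) :
    (dθ^[n] fun R θ => c * f R θ) R θ = c * (dθ^[n] f) R θ :=
  iterate_dθ_const_mul n (fun _ => c) f R θ

/-- `Cⁿ` is inherited by linear combinations with coefficients depending on `R` polynomially:
`(R, θ) ↦ R^m·f(R, θ)`. [folklore] -/
theorem contDiff_pow_fst_mul {f : ℝ → ℝ → ℝ} {n : WithTop ℕ∞} (hf : ContDiff ℝ n (uncurry f)) (m : ℕ) :
    ContDiff ℝ n (uncurry fun R θ => R ^ m * f R θ) := by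
  have e : uncurry (fun R θ => R ^ m * f R θ) = fun p : ℝ × ℝ => p.1 ^ m * uncurry f p := by funext p; rfl
  rw [e]; exact (contDiff_fst.pow m).mul hf

/-! ### `∂_θ^k` commutes with `∂_R` on the strip -/

/-- **`∂_θ^k(∂_Rf) = ∂_R(∂_θ^k f)` on the open strip** for `f ∈ C^{k+1}(ℝ²)`. [folklore] -/
theorem iterate_dθ_dz_comm {f : ℝ → ℝ → ℝ} {k : ℕ} (hf : ContDiff ℝ ((k + 1 : ℕ) : WithTop ℕ∞) (uncurry f)) :
    ∀ p ∈ strip, (dθ^[k] (dz f)) p.1 p.2 = dz (dθ^[k] f) p.1 p.2 := by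
  induction k generalizing f with
  | zero => intro p _; rfl
  | succ k ih =>
    intro p hp
    have hf2 : ContDiff ℝ 2 (uncurry f) := hf.of_le (by exact_mod_cast (show 2 ≤ k + 1 + 1 by omega))
    have hdθf : ContDiff ℝ ((k + 1 : ℕ) : WithTop ℕ∞) (uncurry (dθ f)) := by
      refine contDiff_dθ_of_contDiff ?_
      have e : ((k + 1 + 1 : ℕ) : WithTop ℕ∞) = ((k + 1 : ℕ) : WithTop ℕ∞) + 1 := by push_cast; ring
      rw [← e]; exact hf
    rw [Function.iterate_succ_apply, Function.iterate_succ_apply]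
    -- `dθ^[k] (dθ (dz f)) = dθ^[k] (dz (dθ f))` on the strip, then the induction hypothesis for `dθ f`
    rw [iterate_dθ_congr (fun q hq => dθ_dz_eq_dz_dθ hf2.contDiffOn hq) k p hp]
    exact ih hdθf p hp

/-- **`∂_θ^k(D_Rf) = D_R(∂_θ^k f)` on the open strip** for `f ∈ C^{k+1}(ℝ²)`. [folklore] -/
theorem iterate_dθ_Dz_comm {f : ℝ → ℝ → ℝ} {k : ℕ} (hf : ContDiff ℝ ((k + 1 : ℕ) : WithTop ℕ∞) (uncurry f))
    {p : ℝ × ℝ} (hp : p ∈ strip) : (dθ^[k] (Dz f)) p.1 p.2 = Dz (dθ^[k] f) p.1 p.2 := by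
  have e : Dz f = fun R θ => R * dz f R θ := rfl
  rw [e, iterate_dθ_const_mul k (fun R => R) (dz f), iterate_dθ_dz_comm hf p hp, Dz_eq_mul_dz]

/-! ### The equation behind `A_k` -/

/-- **`L(Φ) + α²R²∂_RRΦ + α(5+α)R∂_RΦ + 6Φ = −∂_θθΦ + ∂_θ(tan θΦ)`** (pointwise, by the form of
the operator). [cite: Elgindi2021, §7.3 proof of Proposition 7.7, Step 4, "−∂_θθΨ + ∂_θ(tan(θ)Ψ) = F₁" (p. 22 of arXiv:1904.04795)] -/
theorem ellipticOp_add_radial (α : ℝ) (Φ : ℝ → ℝ → ℝ) (R θ : ℝ) :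
    ellipticOp α Φ R θ + α ^ 2 * R ^ 2 * dz (dz Φ) R θ + α * (5 + α) * R * dz Φ R θ + 6 * Φ R θ =
      -dθ (dθ Φ) R θ + dθ (fun R θ => Real.tan θ * Φ R θ) R θ := by
  unfold ellipticOp; ring

/-- On the strip, `∂_θ(tan θ·cos θφ) = ∂_θ(sin θφ)`. [folklore] -/
theorem dθ_tan_cosProfile {φ : ℝ → ℝ → ℝ} {Φ : ℝ → ℝ → ℝ} (hΦ : Φ = fun R θ => Real.cos θ * φ R θ)
    {p : ℝ × ℝ} (hp : p ∈ strip) :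
    dθ (fun R θ => Real.tan θ * Φ R θ) p.1 p.2 = dθ (fun R θ => Real.sin θ * φ R θ) p.1 p.2 := by
  refine dθ_congr (fun q hq => ?_) hp
  have hcos : Real.cos q.2 ≠ 0 := (Real.cos_pos_of_mem_Ioo ⟨by linarith [hq.2.1, Real.pi_pos], hq.2.2⟩).ne'
  simp only [hΦ]
  rw [Real.tan_eq_sin_div_cos]; field_simp

/-- **`A_k = ∂_θ^k G` on the open strip**: for `Φ = cos θφ`, `φ ∈ C^{k+2}(ℝ²)`,
`−∂_θ^{k+2}Φ + ∂_θ^{k+1}(sin θφ) = ∂_θ^k(L(Φ) + α²R²∂_RRΦ + α(5+α)R∂_RΦ + 6Φ)` at every point of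
the strip. [cite: Elgindi2021, §7.3 proof of Proposition 7.7, Steps 4–5 ("we differentiate in θ once",
"differentiating the equation twice") and §7.4 (p. 22–23 of arXiv:1904.04795)] -/
theorem iterate_dθ_angular_eq (α : ℝ) (k : ℕ) {φ : ℝ → ℝ → ℝ} (hφ : ContDiff ℝ ((k + 2 : ℕ) : WithTop ℕ∞) (uncurry φ))
    {Φ : ℝ → ℝ → ℝ} (hΦ : Φ = fun R θ => Real.cos θ * φ R θ) {p : ℝ × ℝ} (hp : p ∈ strip) :
    -(dθ^[k + 2] Φ) p.1 p.2 + (dθ^[k + 1] fun R θ => Real.sin θ * φ R θ) p.1 p.2 =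
      (dθ^[k] fun R θ => ellipticOp α Φ R θ + α ^ 2 * R ^ 2 * dz (dz Φ) R θ + α * (5 + α) * R * dz Φ R θ + 6 * Φ R θ) p.1 p.2 := by
  have hΦc : ContDiff ℝ ((k + 2 : ℕ) : WithTop ℕ∞) (uncurry Φ) := by rw [hΦ]; exact contDiff_cosProfile hφ
  have hS : ContDiff ℝ ((k + 2 : ℕ) : WithTop ℕ∞) (uncurry fun R θ => Real.sin θ * φ R θ) := by
    have e : uncurry (fun R θ => Real.sin θ * φ R θ) = fun p : ℝ × ℝ => Real.sin p.2 * uncurry φ p := by funext p; rfl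
    rw [e]; exact (Real.contDiff_sin.comp contDiff_snd).mul hφ
  have hdθΦ : ContDiff ℝ ((k + 1 : ℕ) : WithTop ℕ∞) (uncurry (dθ Φ)) := by
    refine contDiff_dθ_of_contDiff ?_
    have e : ((k + 2 : ℕ) : WithTop ℕ∞) = ((k + 1 : ℕ) : WithTop ℕ∞) + 1 := by push_cast; ring
    rw [← e]; exact hΦc
  have hdθ2Φ : ContDiff ℝ (k : ℕ) (uncurry (dθ (dθ Φ))) := by
    refine contDiff_dθ_of_contDiff ?_
    have e : ((k + 1 : ℕ) : WithTop ℕ∞) = ((k : ℕ) : WithTop ℕ∞) + 1 := by push_cast; ring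
    rw [← e]; exact hdθΦ
  have hdS : ContDiff ℝ ((k + 1 : ℕ) : WithTop ℕ∞) (uncurry (dθ fun R θ => Real.sin θ * φ R θ)) := by
    refine contDiff_dθ_of_contDiff ?_
    have e : ((k + 2 : ℕ) : WithTop ℕ∞) = ((k + 1 : ℕ) : WithTop ℕ∞) + 1 := by push_cast; ring
    rw [← e]; exact hS
  have hdSk : ContDiff ℝ (k : ℕ) (uncurry (dθ fun R θ => Real.sin θ * φ R θ)) :=
    hdS.of_le (by exact_mod_cast Nat.le_succ k)
  -- replace `G` by its smooth form on the strip
  have hG : ∀ q ∈ strip, (fun R θ => ellipticOp α Φ R θ + α ^ 2 * R ^ 2 * dz (dz Φ) R θ + α * (5 + α) * R * dz Φ R θ + 6 * Φ R θ) q.1 q.2 =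
      (fun R θ => -dθ (dθ Φ) R θ + dθ (fun R θ => Real.sin θ * φ R θ) R θ) q.1 q.2 := by
    intro q hq
    simp only []
    rw [ellipticOp_add_radial, dθ_tan_cosProfile hΦ hq]
  rw [iterate_dθ_congr (f := fun R θ => ellipticOp α Φ R θ + α ^ 2 * R ^ 2 * dz (dz Φ) R θ + α * (5 + α) * R * dz Φ R θ + 6 * Φ R θ)
    (g := fun R θ => -dθ (dθ Φ) R θ + dθ (fun R θ => Real.sin θ * φ R θ) R θ) hG k p hp]
  -- linearity
  have e1 : (dθ^[k] fun R θ => -dθ (dθ Φ) R θ + dθ (fun R θ => Real.sin θ * φ R θ) R θ) p.1 p.2 =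
      (dθ^[k] fun R θ => -dθ (dθ Φ) R θ) p.1 p.2 + (dθ^[k] (dθ fun R θ => Real.sin θ * φ R θ)) p.1 p.2 := by
    have hneg : ContDiff ℝ (k : ℕ) (uncurry fun R θ => -dθ (dθ Φ) R θ) := by
      have e : uncurry (fun R θ => -dθ (dθ Φ) R θ) = fun q => -uncurry (dθ (dθ Φ)) q := by funext q; rfl
      rw [e]; exact hdθ2Φ.neg
    exact iterate_dθ_add hneg hdSk p.1 p.2
  rw [e1, iterate_dθ_neg]
  -- re-index the iterates
  have i2 : (dθ^[k + 2] Φ) = dθ^[k] (dθ (dθ Φ)) := by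
    rw [show k + 2 = k + 1 + 1 by ring, Function.iterate_succ_apply, Function.iterate_succ_apply]
  have i1 : (dθ^[k + 1] fun R θ => Real.sin θ * φ R θ) = dθ^[k] (dθ fun R θ => Real.sin θ * φ R θ) := by
    rw [Function.iterate_succ_apply]
  rw [i2, i1]

end Elgindi

end Literature.Analysis.FluidPDE
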